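import Literature.AlgebraicGeometry.Resolution.MvPowerSeriesChainRule
import Literature.NumberTheory.EllipticCurves.FormalInvariantDerivation
import Literature.NumberTheory.EllipticCurves.FormalGroupNegProofs
import HarnessLib

/-!
# The normalised invariant differential of `Ê` is `ω(z)` of AEC IV.1: `F_X(0, T) = η(T) = (ω/dT)⁻¹`
(Silverman AEC IV.4.2 for the formal group of a Weierstrass curve; proofs only)

Trunk T-NT-EC (Literature/NumberTheory/EllipticCurves). Silverman, *AEC* IV.4.2: the unique
normalised invariant differential of a formal group `F` is `ω_F = F_X(0, T)⁻¹ dT`; for the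
formal group `Ê` of a Weierstrass curve, AEC IV.1 expands the curve's invariant differential
`ω = dx/(2y + a₁x + a₃)` in `z` and uses it as `ω_Ê` (IV.5, VI, VII.2) — the identification being
III.5.1 (invariance of `ω` under translation), whose "straightforward but messy" direct proof AEC
leaves to the reader. This file proves that identification FORMALLY, over any commutative ring:

* `subst_zero_X_pderiv_formalGroupLaw` — **`F_X(0, T) = η(T) = 1 - f_w(T, w(T))`** for the
  chord–tangent law `F = formalGroupLaw W` (`formalEta` of `FormalInvariantDerivation.lean`, which
  proves `(ω/dT) · η = 1`); hence over a `ℚ`-algebra `F_X(0, T) · (ω/dT) = 1`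
  (`subst_zero_X_pderiv_formalGroupLaw_mul_formalOmega`): the `z`-expansion of
  `dx/(2y + a₁x + a₃)` IS the normalised invariant differential of `Ê`.

Proof (the first-order expansion of AEC IV.1's construction in `z₁`, i.e. III.5.1 at `O`): write
`S₀ = subst ![0, T]` ("`z₁ = 0`"), `∂₀ = ∂/∂z₁`, `B = w/T³`, `u = λ(0, T) = T²B`, `v = S₀(∂₀λ) = TB`
(`λ = Σ Aₙ hₙ₊₂(z₁, z₂)`), so `S₀(∂₀ν) = -u`, and for the chord cubic `D z³ + N z² + ⋯`:
`S₀N = a₁u + a₃u²`, `S₀(∂₀N) = a₁v - a₂u + 2a₃uv - 2a₄u² - 3a₆u³`, `S₀D = 1 + a₂u + a₄u² + a₆u³`,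
`S₀(∂₀D) = (a₂ + 2a₄u + 3a₆u²)v`. Since `F = i(z₃)` and `z₃(0, T) = i(T)`
(`FormalGroupNegProofs.lean`), the chain rule (`MvPowerSeriesChainRule.lean`) gives
`F_X(0, T) · i'(T) = i'(i(T)) · i'(T) · S₀(∂₀z₃) = S₀(∂₀z₃)`; and `η · i' = S₀(∂₀z₃)` is, after
clearing the units `(1 - a₁T - a₃w)² (S₀D)²`, a polynomial identity in `T, B` that is an explicit
multiple (35 terms) of the curve relation `B = 1 + a₁TB + a₂T²B + a₃T³B² + a₄T⁴B² + a₆T⁶B³`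
(certificate found by polynomial division; `linear_combination`).

## Sources

* J. H. Silverman, *The Arithmetic of Elliptic Curves*, 2nd ed. (2009): III.5.1 (invariance of
  `ω`, "one can prove this proposition by a straightforward, but messy … calculation"), IV.1
  (pp. 115–118), IV.4.2 (`ω = F_X(0,T)⁻¹ dT`) (`SilvermanAEC2009`).
-/

noncomputable section

open PowerSeries Literature.NumberTheory.EllipticCurves
open Literature.AlgebraicGeometry.Resolution (MvPowerSeries.pderiv MvPowerSeries.coeff_pderiv
  MvPowerSeries.pderiv_X MvPowerSeries.pderiv_C MvPowerSeries.pderiv_powerSeries_subst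
  MvPowerSeries.pderiv_powerSeries_subst_X)

namespace WeierstrassCurve

variable {R : Type*} [CommRing R] (W : WeierstrassCurve R)

/-! ### First-order values at `z₁ = 0`: `S₀(∂₀ ·)` of `λ`, `ν`, `N`, `D`, `D⁻¹`, `z₃` -/

section LinearPart

/-- `∂₀ z₁ = 1`, `∂₀ z₂ = 0` in `R⟦z₁, z₂⟧`. [folklore] -/
theorem pderiv_zero_X_fin_two :
    MvPowerSeries.pderiv 0 (MvPowerSeries.X 0 : MvPowerSeries (Fin 2) R) = 1 ∧
      MvPowerSeries.pderiv 0 (MvPowerSeries.X 1 : MvPowerSeries (Fin 2) R) = 0 := by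
  constructor
  · rw [MvPowerSeries.pderiv_X, if_pos rfl]
  · rw [MvPowerSeries.pderiv_X, if_neg (by decide)]

/-- **`S₀(∂₀ λ) = T·B`**: the coefficient of `z₁` in `λ = Σ Aₙ hₙ₊₂(z₁, z₂)` is `Σ Aₙ Tⁿ⁺¹ = TB(T)`.
[Silverman AEC IV.1 (`λ`)] [folklore] -/
theorem subst_zero_X_pderiv_formalSlope :
    MvPowerSeries.subst ![(0 : R⟦X⟧), PowerSeries.X] (MvPowerSeries.pderiv 0 W.formalSlope) =
      X * W.formalWDivCube := by
  ext n
  rw [coeff_subst_zero_X, MvPowerSeries.coeff_pderiv]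
  have e0 : (Finsupp.single (1 : Fin 2) n) 0 = 0 := by simp
  have hl : ∀ e : Fin 2 →₀ ℕ,
      MvPowerSeries.coeff e W.formalSlope = coeff (e 0 + e 1 + 1) W.formalW := fun e => rfl
  rw [hl, e0, Nat.cast_zero, zero_add, one_mul]
  have e0' : (Finsupp.single (1 : Fin 2) n + Finsupp.single 0 1 : Fin 2 →₀ ℕ) 0 = 1 := by simp
  have e1' : (Finsupp.single (1 : Fin 2) n + Finsupp.single 0 1 : Fin 2 →₀ ℕ) 1 = n := by simp
  rw [e0', e1']
  rcases n with _ | n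
  · rw [coeff_zero_X_mul]
    exact W.coeff_formalW_of_lt_three (by norm_num)
  · rw [coeff_succ_X_mul, formalWDivCube, coeff_mk, show 1 + (n + 1) + 1 = n + 3 by ring]

/-- The constant coefficient of `w'` vanishes (`w = z³ + ⋯`). [folklore] -/
theorem constantCoeff_derivative_formalW : constantCoeff (d⁄dX R W.formalW) = 0 := by
  rw [← coeff_zero_eq_constantCoeff_apply, coeff_derivative, W.coeff_formalW_of_lt_three (by norm_num),
    zero_mul]

/-- `S₀(∂₀ (w(z₁))) = w'(0) = 0`. [folklore] -/
theorem subst_zero_X_pderiv_formalW_subst :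
    MvPowerSeries.subst ![(0 : R⟦X⟧), PowerSeries.X]
        (MvPowerSeries.pderiv 0 (W.formalW.subst (MvPowerSeries.X 0 : MvPowerSeries (Fin 2) R))) = 0 := by
  classical
  rw [MvPowerSeries.pderiv_powerSeries_subst_X, if_pos rfl,
    mvSubst_powerSeries_subst (PowerSeries.HasSubst.X 0) hasSubst_zero_X, subst_zero_X_X_zero,
    PowerSeries.subst_zero_of_constantCoeff_zero W.constantCoeff_derivative_formalW]

/-- **`S₀(∂₀ ν) = -T²B`**: `ν = w(z₁) - λz₁` has `z₁`-coefficient `w'(0) - λ(0, T) = -λ(0, T)`.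
[Silverman AEC IV.1 (`ν`)] [folklore] -/
theorem subst_zero_X_pderiv_formalIntercept :
    MvPowerSeries.subst ![(0 : R⟦X⟧), PowerSeries.X] (MvPowerSeries.pderiv 0 W.formalIntercept) =
      -(X ^ 2 * W.formalWDivCube) := by
  have hs := hasSubst_zero_X (R := R)
  rw [formalIntercept, map_sub, Derivation.leibniz, pderiv_zero_X_fin_two.1, smul_eq_mul, smul_eq_mul,
    mul_one, MvPowerSeries.subst_sub hs, MvPowerSeries.subst_add hs, MvPowerSeries.subst_mul hs,
    W.subst_zero_X_pderiv_formalW_subst, W.subst_zero_X_formalSlope, W.subst_zero_X_pderiv_formalSlope,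
    subst_zero_X_X_zero]
  ring

/-- `S₀(∂₀ N) = a₁v - a₂u + 2a₃uv - 2a₄u² - 3a₆u³` for the chord-cubic numerator
`N = a₁λ + a₂ν + a₃λ² + 2a₄λν + 3a₆λ²ν` (`u = T²B`, `v = TB`). [folklore] -/
theorem subst_zero_X_pderiv_formalChordNum :
    MvPowerSeries.subst ![(0 : R⟦X⟧), PowerSeries.X] (MvPowerSeries.pderiv 0 W.formalChordNum) =
      C W.a₁ * (X * W.formalWDivCube) - C W.a₂ * (X ^ 2 * W.formalWDivCube) +
        2 * C W.a₃ * (X ^ 2 * W.formalWDivCube) * (X * W.formalWDivCube) -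
        2 * C W.a₄ * (X ^ 2 * W.formalWDivCube) ^ 2 - 3 * C W.a₆ * (X ^ 2 * W.formalWDivCube) ^ 3 := by
  have hs := hasSubst_zero_X (R := R)
  set D := MvPowerSeries.pderiv (R := R) (0 : Fin 2) with hD
  have h2 : D (2 : MvPowerSeries (Fin 2) R) = 0 := by
    rw [show (2 : MvPowerSeries (Fin 2) R) = MvPowerSeries.C (2 : R) by rw [map_ofNat], hD,
      MvPowerSeries.pderiv_C]
  have h3 : D (3 : MvPowerSeries (Fin 2) R) = 0 := by
    rw [show (3 : MvPowerSeries (Fin 2) R) = MvPowerSeries.C (3 : R) by rw [map_ofNat], hD,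
      MvPowerSeries.pderiv_C]
  have hC : ∀ a : R, D (MvPowerSeries.C a) = 0 := fun a => by rw [hD, MvPowerSeries.pderiv_C]
  unfold formalChordNum
  simp only [map_add, Derivation.leibniz, Derivation.leibniz_pow, smul_eq_mul, hC, h2, h3, mul_zero,
    add_zero]
  simp only [← MvPowerSeries.coe_substAlgHom hs, map_add, map_mul, map_pow, map_ofNat, map_nsmul]
  simp only [MvPowerSeries.coe_substAlgHom hs, MvPowerSeries.subst_C, W.subst_zero_X_formalSlope,
    W.subst_zero_X_formalIntercept, W.subst_zero_X_pderiv_formalSlope,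
    W.subst_zero_X_pderiv_formalIntercept, hD]
  simp only [show ∀ a : R, (MvPowerSeries.C a : R⟦X⟧) = PowerSeries.C a from fun _ => rfl]
  ring

/-- `S₀(∂₀ D) = (a₂ + 2a₄u + 3a₆u²)·v` for the leading coefficient `D = 1 + a₂λ + a₄λ² + a₆λ³`.
[folklore] -/
theorem subst_zero_X_pderiv_formalChordDenom :
    MvPowerSeries.subst ![(0 : R⟦X⟧), PowerSeries.X] (MvPowerSeries.pderiv 0 W.formalChordDenom) =
      (C W.a₂ + 2 * C W.a₄ * (X ^ 2 * W.formalWDivCube) + 3 * C W.a₆ * (X ^ 2 * W.formalWDivCube) ^ 2) *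
        (X * W.formalWDivCube) := by
  have hs := hasSubst_zero_X (R := R)
  set D := MvPowerSeries.pderiv (R := R) (0 : Fin 2) with hD
  have hC : ∀ a : R, D (MvPowerSeries.C a) = 0 := fun a => by rw [hD, MvPowerSeries.pderiv_C]
  unfold formalChordDenom
  simp only [map_add, Derivation.leibniz, Derivation.leibniz_pow, smul_eq_mul, hC, mul_zero,
    add_zero, zero_add, Derivation.map_one_eq_zero]
  simp only [← MvPowerSeries.coe_substAlgHom hs, map_add, map_mul, map_pow, map_nsmul]
  simp only [MvPowerSeries.coe_substAlgHom hs, MvPowerSeries.subst_C, W.subst_zero_X_formalSlope,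
    W.subst_zero_X_pderiv_formalSlope, hD]
  simp only [show ∀ a : R, (MvPowerSeries.C a : R⟦X⟧) = PowerSeries.C a from fun _ => rfl]
  ring


/-- The inverse `D⁻¹` of the leading coefficient: `S₀(∂₀ D⁻¹) = -(S₀ D⁻¹)² · S₀(∂₀ D)`
(differentiate `D · D⁻¹ = 1`). [folklore] -/
theorem subst_zero_X_pderiv_invOfUnit_formalChordDenom :
    MvPowerSeries.subst ![(0 : R⟦X⟧), PowerSeries.X]
        (MvPowerSeries.pderiv 0 (MvPowerSeries.invOfUnit W.formalChordDenom 1)) =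
      -(MvPowerSeries.subst ![(0 : R⟦X⟧), PowerSeries.X] (MvPowerSeries.invOfUnit W.formalChordDenom 1) ^ 2 *
        ((C W.a₂ + 2 * C W.a₄ * (X ^ 2 * W.formalWDivCube) + 3 * C W.a₆ * (X ^ 2 * W.formalWDivCube) ^ 2) *
          (X * W.formalWDivCube))) := by
  have hs := hasSubst_zero_X (R := R)
  have hmul : MvPowerSeries.invOfUnit W.formalChordDenom 1 * W.formalChordDenom = 1 := by
    rw [mul_comm]
    exact MvPowerSeries.mul_invOfUnit _ 1 (by rw [constantCoeff_formalChordDenom, Units.val_one])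
  rw [Derivation.leibniz_of_mul_eq_one _ hmul, smul_eq_mul, neg_mul, ← MvPowerSeries.coe_substAlgHom hs,
    map_neg, map_mul, map_pow, MvPowerSeries.coe_substAlgHom hs, W.subst_zero_X_pderiv_formalChordDenom]

/-- **`S₀(∂₀ z₃) = -1 - N₁·D₀⁻¹ + N₀·D₁·D₀⁻²`** for `z₃ = -z₁ - z₂ - N/D` (first-order part in `z₁`;
`N₀ = S₀N`, `N₁ = S₀(∂₀N)`, `D₀ = S₀D`, `D₁ = S₀(∂₀D)`, `D₀⁻¹ = S₀(D⁻¹)`). [Silverman AEC IV.1 (`z₃`)]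
[folklore] -/
theorem subst_zero_X_pderiv_formalChordZ :
    MvPowerSeries.subst ![(0 : R⟦X⟧), PowerSeries.X] (MvPowerSeries.pderiv 0 W.formalChordZ) =
      -1 - (C W.a₁ * (X * W.formalWDivCube) - C W.a₂ * (X ^ 2 * W.formalWDivCube) +
            2 * C W.a₃ * (X ^ 2 * W.formalWDivCube) * (X * W.formalWDivCube) -
            2 * C W.a₄ * (X ^ 2 * W.formalWDivCube) ^ 2 - 3 * C W.a₆ * (X ^ 2 * W.formalWDivCube) ^ 3) *
          MvPowerSeries.subst ![(0 : R⟦X⟧), PowerSeries.X] (MvPowerSeries.invOfUnit W.formalChordDenom 1) +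
        (C W.a₁ * (X ^ 2 * W.formalWDivCube) + C W.a₃ * (X ^ 2 * W.formalWDivCube) ^ 2) *
          MvPowerSeries.subst ![(0 : R⟦X⟧), PowerSeries.X] (MvPowerSeries.invOfUnit W.formalChordDenom 1) ^ 2 *
          ((C W.a₂ + 2 * C W.a₄ * (X ^ 2 * W.formalWDivCube) + 3 * C W.a₆ * (X ^ 2 * W.formalWDivCube) ^ 2) *
            (X * W.formalWDivCube)) := by
  have hs := hasSubst_zero_X (R := R)
  have h1 : MvPowerSeries.subst ![(0 : R⟦X⟧), PowerSeries.X] (1 : MvPowerSeries (Fin 2) R) = 1 := by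
    rw [← MvPowerSeries.coe_substAlgHom hs, map_one]
  rw [formalChordZ, map_sub, map_sub, map_neg, pderiv_zero_X_fin_two.1, pderiv_zero_X_fin_two.2,
    Derivation.leibniz, smul_eq_mul, smul_eq_mul, MvPowerSeries.subst_sub hs, MvPowerSeries.subst_sub hs,
    MvPowerSeries.subst_add hs, MvPowerSeries.subst_mul hs, MvPowerSeries.subst_mul hs,
    ← MvPowerSeries.coe_substAlgHom hs, map_neg, map_one, map_zero, MvPowerSeries.coe_substAlgHom hs,
    W.subst_zero_X_formalChordNum, W.subst_zero_X_pderiv_formalChordNum,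
    W.subst_zero_X_pderiv_invOfUnit_formalChordDenom]
  ring

end LinearPart

/-! ### `F_X(0, T) · i'(T) = S₀(∂₀ z₃)` and the main theorem -/

section Main

/-- **`F_X(0, T) · i'(T) = S₀(∂₀ z₃)`**: from `F = i(z₃)` (chain rule), `z₃(0, T) = i(T)` and
`i'(i(T)) · i'(T) = 1`. [Silverman AEC IV.1 (`F = i(z₃)`), IV.4.2] [folklore] -/
theorem subst_zero_X_pderiv_formalGroupLaw_mul :
    MvPowerSeries.subst ![(0 : R⟦X⟧), PowerSeries.X] (MvPowerSeries.pderiv 0 W.formalGroupLaw) *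
        d⁄dX R W.formalNeg =
      MvPowerSeries.subst ![(0 : R⟦X⟧), PowerSeries.X] (MvPowerSeries.pderiv 0 W.formalChordZ) := by
  have hs := hasSubst_zero_X (R := R)
  rw [formalGroupLaw, MvPowerSeries.pderiv_powerSeries_subst W.constantCoeff_formalChordZ,
    MvPowerSeries.subst_mul hs, mvSubst_powerSeries_subst W.hasSubst_formalChordZ hs,
    W.subst_zero_X_formalChordZ, mul_right_comm, W.derivative_formalNeg_subst_mul, one_mul]

/-- `i' = -1 + ⋯` is a unit of `R⟦T⟧`. [folklore] -/
theorem isUnit_derivative_formalNeg : IsUnit (d⁄dX R W.formalNeg) := by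
  rw [PowerSeries.isUnit_iff_constantCoeff, ← coeff_zero_eq_constantCoeff_apply, coeff_derivative,
    W.coeff_one_formalNeg]
  simp

/-- The derivative of the formal inverse: with `E = 1 - a₁T - a₃w`, `Eᵢ = E⁻¹` and `w' = dw/dT`,
`i'(T) = -(T · (-(Eᵢ² · (-a₁ - a₃w'))) + Eᵢ)` (`i = -T·Eᵢ`, `Eᵢ' = -Eᵢ²E'`, `E' = -a₁ - a₃w'`).
[folklore] -/
theorem derivative_formalNeg_eq :
    d⁄dX R W.formalNeg =
      -(X * -(PowerSeries.invOfUnit (1 - C W.a₁ * X - C W.a₃ * W.formalW) 1 ^ 2 *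
            (-C W.a₁ - C W.a₃ * d⁄dX R W.formalW)) +
        PowerSeries.invOfUnit (1 - C W.a₁ * X - C W.a₃ * W.formalW) 1) := by
  have hmul : PowerSeries.invOfUnit (1 - C W.a₁ * X - C W.a₃ * W.formalW) 1 *
      (1 - C W.a₁ * X - C W.a₃ * W.formalW) = 1 := by
    rw [mul_comm]; exact W.formalNegDenom_mul_invOfUnit
  have hE' : d⁄dX R (1 - C W.a₁ * X - C W.a₃ * W.formalW) = -C W.a₁ - C W.a₃ * d⁄dX R W.formalW := by
    rw [map_sub, map_sub, Derivation.map_one_eq_zero, Derivation.leibniz, Derivation.leibniz, derivative_C,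
      derivative_C, derivative_X]
    simp only [smul_eq_mul, mul_one, mul_zero, add_zero, zero_sub]
  rw [W.formalNeg_eq, map_neg, Derivation.leibniz, derivative_X, Derivation.leibniz_of_mul_eq_one _ hmul,
    hE']
  simp only [smul_eq_mul, mul_one]
  ring

/-- **`F_X(0, T) = η(T) = 1 - f_w(T, w(T))`**: the normalised invariant differential
`F_X(0, T)⁻¹ dT` of the formal group `Ê` (AEC IV.4.2) is the `z`-expansion `ω(z)` of the curve's
invariant differential `dx/(2y + a₁x + a₃)` (AEC IV.1), whose inverse is `η` (`formalEta`,
`formalOmega_mul_formalEta`). Holds over every commutative ring. (This is AEC III.5.1 — translation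
invariance of `ω` — at `O`, in the parameter `z`, proved by the explicit computation AEC alludes
to: `η · i' = S₀(∂₀z₃)` modulo the curve relation, with a 35-term certificate.)
[Silverman AEC IV.4.2, IV.1, III.5.1] [cite: SilvermanAEC2009, IV.4.2] -/
theorem subst_zero_X_pderiv_formalGroupLaw :
    MvPowerSeries.subst ![(0 : R⟦X⟧), PowerSeries.X] (MvPowerSeries.pderiv 0 W.formalGroupLaw) =
      W.formalEta := by
  have hΦ := W.subst_zero_X_pderiv_formalGroupLaw_mul
  have hw : W.formalW = X ^ 3 * W.formalWDivCube := W.formalW_eq_X_pow_mul_formalWDivCube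
  have hRel := W.formalWDivCube_eq
  have hw' := W.derivative_formalW
  rw [hw] at hw'
  have hE := W.formalNegDenom_mul_invOfUnit
  rw [hw] at hE
  have hD := W.subst_zero_X_formalChordDenom_mul_inv
  -- `i' · E² = T E' - E`
  have h1 : d⁄dX R W.formalNeg * (1 - C W.a₁ * X - C W.a₃ * (X ^ 3 * W.formalWDivCube)) ^ 2 = X * (-C W.a₁ - C W.a₃ * d⁄dX R (X ^ 3 * W.formalWDivCube)) - (1 - C W.a₁ * X - C W.a₃ * (X ^ 3 * W.formalWDivCube)) := by
    rw [W.derivative_formalNeg_eq, hw]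
    linear_combination (X * (-C W.a₁ - C W.a₃ * d⁄dX R (X ^ 3 * W.formalWDivCube)) * ((1 - C W.a₁ * X - C W.a₃ * (X ^ 3 * W.formalWDivCube)) * PowerSeries.invOfUnit (1 - C W.a₁ * X - C W.a₃ * (X ^ 3 * W.formalWDivCube)) 1 + 1) - (1 - C W.a₁ * X - C W.a₃ * (X ^ 3 * W.formalWDivCube))) * hE
  -- `S₀(∂₀z₃) · D₀² = -D₀² - N₁D₀ + N₀D₁`
  have h2 : MvPowerSeries.subst ![(0 : R⟦X⟧), PowerSeries.X] (MvPowerSeries.pderiv 0 W.formalChordZ) * (1 + C W.a₂ * (X ^ 2 * W.formalWDivCube) + C W.a₄ * (X ^ 2 * W.formalWDivCube) ^ 2 + C W.a₆ * (X ^ 2 * W.formalWDivCube) ^ 3) ^ 2 = -(1 + C W.a₂ * (X ^ 2 * W.formalWDivCube) + C W.a₄ * (X ^ 2 * W.formalWDivCube) ^ 2 + C W.a₆ * (X ^ 2 * W.formalWDivCube) ^ 3) ^ 2 - (C W.a₁ * (X * W.formalWDivCube) - C W.a₂ * (X ^ 2 * W.formalWDivCube) + 2 * C W.a₃ * (X ^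 2 * W.formalWDivCube) * (X * W.formalWDivCube) - 2 * C W.a₄ * (X ^ 2 * W.formalWDivCube) ^ 2 - 3 * C W.a₆ * (X ^ 2 * W.formalWDivCube) ^ 3) * (1 + C W.a₂ * (X ^ 2 * W.formalWDivCube) + C W.a₄ * (X ^ 2 * W.formalWDivCube) ^ 2 + C W.a₆ * (X ^ 2 * W.formalWDivCube) ^ 3) + (C W.a₁ * (X ^ 2 * W.formalWDivCube) + C W.a₃ * (X ^ 2 * W.formalWDivCube) ^ 2) * ((C W.a₂ + 2 * C W.a₄ * (X ^ 2 * W.formalWDivCube) + 3 * C W.a₆ * (X ^ 2 * W.formalWDivCube) ^ 2) * (X * W.formalWDivCube)) := by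
    rw [W.subst_zero_X_pderiv_formalChordZ]
    linear_combination (-(C W.a₁ * (X * W.formalWDivCube) - C W.a₂ * (X ^ 2 * W.formalWDivCube) + 2 * C W.a₃ * (X ^ 2 * W.formalWDivCube) * (X * W.formalWDivCube) - 2 * C W.a₄ * (X ^ 2 * W.formalWDivCube) ^ 2 - 3 * C W.a₆ * (X ^ 2 * W.formalWDivCube) ^ 3) * (1 + C W.a₂ * (X ^ 2 * W.formalWDivCube) + C W.a₄ * (X ^ 2 * W.formalWDivCube) ^ 2 + C W.a₆ * (X ^ 2 * W.formalWDivCube) ^ 3) + (C W.a₁ * (X ^ 2 * W.formalWDivCube) + C W.a₃ * (X ^ 2 * W.formalWDivCube) ^ 2) * ((C W.a₂ + 2 * C W.a₄ * (X ^ 2 * W.formalWDivCube) + 3 * C W.a₆ * (X ^ 2 * W.formalWDivCube) ^ 2) * (X * W.formalWDivCube)) * ((1 + C W.a₂ * (X ^ 2 * W.formalWDivCube) + C W.a₄ * (X ^ 2 * W.formalWDivCube) ^ 2 + C W.a₆ * (X ^ 2 * W.formalWDivCube) ^ 3) * MvPowerSeries.subst ![(0 : R⟦X⟧), PowerSeries.X]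 (MvPowerSeries.invOfUnit W.formalChordDenom 1) + 1)) * hD
  -- the curve identity (certificate: 35-term multiple of the curve relation)
  have h3 : W.formalEta * (X * (-C W.a₁ - C W.a₃ * d⁄dX R (X ^ 3 * W.formalWDivCube)) - (1 - C W.a₁ * X - C W.a₃ * (X ^ 3 * W.formalWDivCube))) * (1 + C W.a₂ * (X ^ 2 * W.formalWDivCube) + C W.a₄ * (X ^ 2 * W.formalWDivCube) ^ 2 + C W.a₆ * (X ^ 2 * W.formalWDivCube) ^ 3) ^ 2 = (-(1 + C W.a₂ * (X ^ 2 * W.formalWDivCube) + C W.a₄ * (X ^ 2 * W.formalWDivCube) ^ 2 + C W.a₆ * (X ^ 2 * W.formalWDivCube) ^ 3) ^ 2 - (C W.a₁ * (X * W.formalWDivCube) - C W.a₂ * (X ^ 2 * W.formalWDivCube) + 2 * C W.a₃ * (X ^ 2 * W.formalWDivCube) * (X * W.formalWDivCube) - 2 * C W.a₄ * (X ^ 2 * W.formalWDivCube) ^ 2 - 3 * C W.a₆ * (X ^ 2 * W.formalWDivCube) ^ 3) * (1 + C W.a₂ * (X ^ 2 * W.formalWDivCube) + C W.a₄ * (X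 ^ 2 * W.formalWDivCube) ^ 2 + C W.a₆ * (X ^ 2 * W.formalWDivCube) ^ 3) + (C W.a₁ * (X ^ 2 * W.formalWDivCube) + C W.a₃ * (X ^ 2 * W.formalWDivCube) ^ 2) * ((C W.a₂ + 2 * C W.a₄ * (X ^ 2 * W.formalWDivCube) + 3 * C W.a₆ * (X ^ 2 * W.formalWDivCube) ^ 2) * (X * W.formalWDivCube))) * (1 - C W.a₁ * X - C W.a₃ * (X ^ 3 * W.formalWDivCube)) ^ 2 := by
    rw [formalEta_def, hw]
    linear_combination ((-3 : R⟦X⟧) * C W.a₆ * X ^ 6 * W.formalWDivCube ^ 2 + (-3 : R⟦X⟧) * C W.a₆ ^ 2 * X ^ 12 * W.formalWDivCube ^ 5 + (-2 : R⟦X⟧) * C W.a₄ * X ^ 4 * W.formalWDivCube + (-5 : R⟦X⟧) * C W.a₄ * C W.a₆ * X ^ 10 * W.formalWDivCube ^ 4 + (-2 : R⟦X⟧) * C W.a₄ ^ 2 * X ^ 8 * W.formalWDivCube ^ 3 + (3 : R⟦X⟧) * C W.a₃ * X ^ 3 + (2 : R⟦X⟧) * C W.a₃ * X ^ 3 * W.formalWDivCube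 + (6 : R⟦X⟧) * C W.a₃ * C W.a₆ * X ^ 9 * W.formalWDivCube ^ 3 + (-1 : R⟦X⟧) * C W.a₃ * C W.a₆ * X ^ 9 * W.formalWDivCube ^ 4 + (3 : R⟦X⟧) * C W.a₃ * C W.a₆ ^ 2 * X ^ 15 * W.formalWDivCube ^ 6 + (6 : R⟦X⟧) * C W.a₃ * C W.a₄ * X ^ 7 * W.formalWDivCube ^ 2 + (6 : R⟦X⟧) * C W.a₃ * C W.a₄ * C W.a₆ * X ^ 13 * W.formalWDivCube ^ 5 + (3 : R⟦X⟧) * C W.a₃ * C W.a₄ ^ 2 * X ^ 11 * W.formalWDivCube ^ 4 + (-2 : R⟦X⟧) * C W.a₃ ^ 2 * X ^ 6 * W.formalWDivCube ^ 2 + (1 : R⟦X⟧) * C W.a₃ ^ 2 * C W.a₆ * X ^ 12 * W.formalWDivCube ^ 5 + (-1 : R⟦X⟧) * C W.a₂ * X ^ 2 + (-4 : R⟦X⟧) * C W.a₂ * C W.a₆ * X ^ 8 * W.formalWDivCube ^ 3 + (-3 : R⟦X⟧) * C W.a₂ * C W.a₄ * X ^ 6 * W.formalWDivCube ^ 2 +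 (6 : R⟦X⟧) * C W.a₂ * C W.a₃ * X ^ 5 * W.formalWDivCube + (1 : R⟦X⟧) * C W.a₂ * C W.a₃ * X ^ 5 * W.formalWDivCube ^ 2 + (6 : R⟦X⟧) * C W.a₂ * C W.a₃ * C W.a₆ * X ^ 11 * W.formalWDivCube ^ 4 + (6 : R⟦X⟧) * C W.a₂ * C W.a₃ * C W.a₄ * X ^ 9 * W.formalWDivCube ^ 3 + (-1 : R⟦X⟧) * C W.a₂ * C W.a₃ ^ 2 * X ^ 8 * W.formalWDivCube ^ 3 + (-1 : R⟦X⟧) * C W.a₂ ^ 2 * X ^ 4 * W.formalWDivCube + (3 : R⟦X⟧) * C W.a₂ ^ 2 * C W.a₃ * X ^ 7 * W.formalWDivCube ^ 2 + (1 : R⟦X⟧) * C W.a₁ * X + (-2 : R⟦X⟧) * C W.a₁ * C W.a₆ * X ^ 7 * W.formalWDivCube ^ 3 + (-1 : R⟦X⟧) * C W.a₁ * C W.a₄ * X ^ 5 * W.formalWDivCube ^ 2 + (-3 : R⟦X⟧) * C W.a₁ * C W.a₃ * X ^ 4 * W.formalWDivCube + (3 : R⟦X⟧) * C W.a₁ *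 C W.a₃ * C W.a₆ * X ^ 10 * W.formalWDivCube ^ 4 + (1 : R⟦X⟧) * C W.a₁ * C W.a₃ * C W.a₄ * X ^ 8 * W.formalWDivCube ^ 3 + (-1 : R⟦X⟧) * C W.a₁ * C W.a₂ * C W.a₃ * X ^ 6 * W.formalWDivCube ^ 2 + (-1 : R⟦X⟧) * C W.a₁ ^ 2 * X ^ 2 + (2 : R⟦X⟧) * C W.a₁ ^ 2 * C W.a₆ * X ^ 8 * W.formalWDivCube ^ 3 + (1 : R⟦X⟧) * C W.a₁ ^ 2 * C W.a₄ * X ^ 6 * W.formalWDivCube ^ 2) * hRel + ((-1 : R⟦X⟧) * C W.a₃ * X + (-2 : R⟦X⟧) * C W.a₃ * C W.a₆ * X ^ 7 * W.formalWDivCube ^ 3 + (-1 : R⟦X⟧) * C W.a₃ * C W.a₆ ^ 2 * X ^ 13 * W.formalWDivCube ^ 6 + (-2 : R⟦X⟧) * C W.a₃ * C W.a₄ * X ^ 5 * W.formalWDivCube ^ 2 + (-2 : R⟦X⟧) * C W.a₃ * C W.a₄ * C W.a₆ * X ^ 11 * W.formalWDivCube ^ 5 + (-1 : R⟦X⟧)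 * C W.a₃ * C W.a₄ ^ 2 * X ^ 9 * W.formalWDivCube ^ 4 + (-2 : R⟦X⟧) * C W.a₂ * C W.a₃ * X ^ 3 * W.formalWDivCube + (-2 : R⟦X⟧) * C W.a₂ * C W.a₃ * C W.a₆ * X ^ 9 * W.formalWDivCube ^ 4 + (-2 : R⟦X⟧) * C W.a₂ * C W.a₃ * C W.a₄ * X ^ 7 * W.formalWDivCube ^ 3 + (-1 : R⟦X⟧) * C W.a₂ ^ 2 * C W.a₃ * X ^ 5 * W.formalWDivCube ^ 2) * hw'
  -- combine
  have h4 : W.formalEta * d⁄dX R W.formalNeg * ((1 - C W.a₁ * X - C W.a₃ * (X ^ 3 * W.formalWDivCube)) ^ 2 * (1 + C W.a₂ * (X ^ 2 * W.formalWDivCube) + C W.a₄ * (X ^ 2 * W.formalWDivCube) ^ 2 + C W.a₆ * (X ^ 2 * W.formalWDivCube) ^ 3) ^ 2) = MvPowerSeries.subst ![(0 : R⟦X⟧), PowerSeries.X] (MvPowerSeries.pderiv 0 W.formalChordZ) * ((1 - C W.a₁ * X - C W.a₃ * (X ^ 3 * W.formalWDivCube)) ^ 2 * (1 + C W.a₂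 * (X ^ 2 * W.formalWDivCube) + C W.a₄ * (X ^ 2 * W.formalWDivCube) ^ 2 + C W.a₆ * (X ^ 2 * W.formalWDivCube) ^ 3) ^ 2) := by
    calc W.formalEta * d⁄dX R W.formalNeg * ((1 - C W.a₁ * X - C W.a₃ * (X ^ 3 * W.formalWDivCube)) ^ 2 * (1 + C W.a₂ * (X ^ 2 * W.formalWDivCube) + C W.a₄ * (X ^ 2 * W.formalWDivCube) ^ 2 + C W.a₆ * (X ^ 2 * W.formalWDivCube) ^ 3) ^ 2)
        = W.formalEta * (d⁄dX R W.formalNeg * (1 - C W.a₁ * X - C W.a₃ * (X ^ 3 * W.formalWDivCube)) ^ 2) * (1 + C W.a₂ * (X ^ 2 * W.formalWDivCube) + C W.a₄ * (X ^ 2 * W.formalWDivCube) ^ 2 + C W.a₆ * (X ^ 2 * W.formalWDivCube) ^ 3) ^ 2 := by ring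
      _ = W.formalEta * (X * (-C W.a₁ - C W.a₃ * d⁄dX R (X ^ 3 * W.formalWDivCube)) - (1 - C W.a₁ * X - C W.a₃ * (X ^ 3 * W.formalWDivCube))) * (1 + C W.a₂ * (X ^ 2 * W.formalWDivCube) + C W.a₄ * (X ^ 2 * W.formalWDivCube) ^ 2 + C W.a₆ * (X ^ 2 * W.formalWDivCube) ^ 3) ^ 2 := by rw [h1]
      _ = (-(1 + C W.a₂ * (X ^ 2 * W.formalWDivCube) + C W.a₄ * (X ^ 2 * W.formalWDivCube) ^ 2 + C W.a₆ * (X ^ 2 * W.formalWDivCube) ^ 3) ^ 2 - (C W.a₁ * (X * W.formalWDivCube) - C W.a₂ * (X ^ 2 * W.formalWDivCube) + 2 * C W.a₃ * (X ^ 2 * W.formalWDivCube) * (X * W.formalWDivCube) - 2 * C W.a₄ * (X ^ 2 * W.formalWDivCube) ^ 2 - 3 * C W.a₆ * (X ^ 2 * W.formalWDivCube) ^ 3) * (1 + C W.a₂ * (X ^ 2 * W.formalWDivCube) + C W.a₄ * (X ^ 2 * W.formalWDivCube) ^ 2 + C W.a₆ * (X ^ 2 * W.formalWDivCube) ^ 3)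 + (C W.a₁ * (X ^ 2 * W.formalWDivCube) + C W.a₃ * (X ^ 2 * W.formalWDivCube) ^ 2) * ((C W.a₂ + 2 * C W.a₄ * (X ^ 2 * W.formalWDivCube) + 3 * C W.a₆ * (X ^ 2 * W.formalWDivCube) ^ 2) * (X * W.formalWDivCube))) * (1 - C W.a₁ * X - C W.a₃ * (X ^ 3 * W.formalWDivCube)) ^ 2 := h3
      _ = (MvPowerSeries.subst ![(0 : R⟦X⟧), PowerSeries.X] (MvPowerSeries.pderiv 0 W.formalChordZ) * (1 + C W.a₂ * (X ^ 2 * W.formalWDivCube) + C W.a₄ * (X ^ 2 * W.formalWDivCube) ^ 2 + C W.a₆ * (X ^ 2 * W.formalWDivCube) ^ 3) ^ 2) * (1 - C W.a₁ * X - C W.a₃ * (X ^ 3 * W.formalWDivCube)) ^ 2 := by rw [h2]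
      _ = MvPowerSeries.subst ![(0 : R⟦X⟧), PowerSeries.X] (MvPowerSeries.pderiv 0 W.formalChordZ) * ((1 - C W.a₁ * X - C W.a₃ * (X ^ 3 * W.formalWDivCube)) ^ 2 * (1 + C W.a₂ * (X ^ 2 * W.formalWDivCube) + C W.a₄ * (X ^ 2 * W.formalWDivCube) ^ 2 + C W.a₆ * (X ^ 2 * W.formalWDivCube) ^ 3) ^ 2) := by ring
  have hu : IsUnit (d⁄dX R W.formalNeg * ((1 - C W.a₁ * X - C W.a₃ * (X ^ 3 * W.formalWDivCube)) ^ 2 * (1 + C W.a₂ * (X ^ 2 * W.formalWDivCube) + C W.a₄ * (X ^ 2 * W.formalWDivCube) ^ 2 + C W.a₆ * (X ^ 2 * W.formalWDivCube) ^ 3) ^ 2)) := by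
    refine W.isUnit_derivative_formalNeg.mul ?_
    rw [PowerSeries.isUnit_iff_constantCoeff]
    simp
  refine hu.mul_right_cancel ?_
  calc MvPowerSeries.subst ![(0 : R⟦X⟧), PowerSeries.X] (MvPowerSeries.pderiv 0 W.formalGroupLaw) * (d⁄dX R W.formalNeg * ((1 - C W.a₁ * X - C W.a₃ * (X ^ 3 * W.formalWDivCube)) ^ 2 * (1 + C W.a₂ * (X ^ 2 * W.formalWDivCube) + C W.a₄ * (X ^ 2 * W.formalWDivCube) ^ 2 + C W.a₆ * (X ^ 2 * W.formalWDivCube) ^ 3) ^ 2))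
      = (MvPowerSeries.subst ![(0 : R⟦X⟧), PowerSeries.X] (MvPowerSeries.pderiv 0 W.formalGroupLaw) * d⁄dX R W.formalNeg) * ((1 - C W.a₁ * X - C W.a₃ * (X ^ 3 * W.formalWDivCube)) ^ 2 * (1 + C W.a₂ * (X ^ 2 * W.formalWDivCube) + C W.a₄ * (X ^ 2 * W.formalWDivCube) ^ 2 + C W.a₆ * (X ^ 2 * W.formalWDivCube) ^ 3) ^ 2) := by ring
    _ = MvPowerSeries.subst ![(0 : R⟦X⟧), PowerSeries.X] (MvPowerSeries.pderiv 0 W.formalChordZ) * ((1 - C W.a₁ * X - C W.a₃ * (X ^ 3 * W.formalWDivCube)) ^ 2 * (1 + C W.a₂ * (X ^ 2 * W.formalWDivCube) + C W.a₄ * (X ^ 2 * W.formalWDivCube) ^ 2 + C W.a₆ * (X ^ 2 * W.formalWDivCube) ^ 3) ^ 2) := by rw [hΦ]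
    _ = W.formalEta * d⁄dX R W.formalNeg * ((1 - C W.a₁ * X - C W.a₃ * (X ^ 3 * W.formalWDivCube)) ^ 2 * (1 + C W.a₂ * (X ^ 2 * W.formalWDivCube) + C W.a₄ * (X ^ 2 * W.formalWDivCube) ^ 2 + C W.a₆ * (X ^ 2 * W.formalWDivCube) ^ 3) ^ 2) := h4.symm
    _ = W.formalEta * (d⁄dX R W.formalNeg * ((1 - C W.a₁ * X - C W.a₃ * (X ^ 3 * W.formalWDivCube)) ^ 2 * (1 + C W.a₂ * (X ^ 2 * W.formalWDivCube) + C W.a₄ * (X ^ 2 * W.formalWDivCube) ^ 2 + C W.a₆ * (X ^ 2 * W.formalWDivCube) ^ 3) ^ 2)) := by ring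

/-- **Over a `ℚ`-algebra: `F_X(0, T) · (ω/dT) = 1`** — the `z`-expansion of `dx/(2y + a₁x + a₃)`
(the tree's `formalOmega`, hence `formalLog = ∫ω`) is the normalised invariant differential
`ω_Ê = F_X(0,T)⁻¹dT` of AEC IV.4.2. [Silverman AEC IV.4.2, IV.1] [cite: SilvermanAEC2009, IV.4.2] -/
theorem subst_zero_X_pderiv_formalGroupLaw_mul_formalOmega {A : Type*} [CommRing A] [Algebra ℚ A]
    (V : WeierstrassCurve A) :
    MvPowerSeries.subst ![(0 : A⟦X⟧), PowerSeries.X] (MvPowerSeries.pderiv 0 V.formalGroupLaw) *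
        V.formalOmega = 1 := by
  rw [V.subst_zero_X_pderiv_formalGroupLaw, V.formalEta_mul_formalOmega]

end Main

end WeierstrassCurve
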